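import Summits.KontsevichZagierPeriods.KontsevichZagierPeriods.Theses.SymplecticScissors
import Literature.NumberTheory.Transcendental.AyoubPeriodSeries
import Literature.NumberTheory.Transcendental.AyoubPeriodSeriesKernel
import Literature.NumberTheory.Transcendental.AyoubPeriodSeriesPiAlgebraic
import Literature.NumberTheory.Transcendental.AyoubPeriodSeriesLocalizing
import Literature.NumberTheory.Transcendental.AyoubPeriodSeriesProofs
import Mathlib.RingTheory.MvPowerSeries.Rename
import Summits.KontsevichZagierPeriods.KontsevichZagierPeriods.Theorems.UnfoldedStokesStokesGenerationStubSpanToRepsAuxCoeff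
import Summits.KontsevichZagierPeriods.KontsevichZagierPeriods.Theorems.SymplecticScissorsTypeAGenerationStubPdzCalculus
import Summits.KontsevichZagierPeriods.KontsevichZagierPeriods.Theorems.SymplecticScissorsTypeAGenerationStubRestrCOneAux
import Summits.KontsevichZagierPeriods.KontsevichZagierPeriods.Theorems.SymplecticScissorsTypeAGenerationStubRestrCZero
import Summits.KontsevichZagierPeriods.KontsevichZagierPeriods.Theorems.SymplecticScissorsTypeAGenerationStubRoomLemmaIter
import Summits.KontsevichZagierPeriods.KontsevichZagierPeriods.Theorems.SymplecticScissorsTypeAGenerationStubExactDlogAux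
import Summits.KontsevichZagierPeriods.KontsevichZagierPeriods.Theorems.SymplecticScissorsTypeAGenerationStubCovPolyAux
import Summits.KontsevichZagierPeriods.KontsevichZagierPeriods.Theorems.SymplecticScissorsTypeAGenerationStubRenameSpan

/-!
# `TypeAGeneration` (stmt-KontsevichZagierPeriods-18392), line `Sketch`, stub
`stub_moduleDisjoint_of` (M1): the `ℚ`-span of type (a) is a module under disjoint-variable products

Registered stub `stub_moduleDisjoint_of` of the crux `TypeAGeneration` (route SymplecticScissors,
line `Sketch` = card stokes-compiler), on top of
`Literature/NumberTheory/Transcendental/AyoubPeriodSeries.lean` (`AyoubRel.Oan σ = 𝒪_{k-alg}(𝔻̄^∞)`,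
`AyoubRel.relAC i G = ∂G/∂zᵢ − G|_{zᵢ=1} + G|_{zᵢ=0}`, `AyoubRel.kSpan`, `AyoubRel.UsesVar`) and of
the sibling stub files (Leibniz rule `w1_pdz_mul`, the product rules `s4_restrC_mul`,
`s8_restrC_zero_mul` of the two face maps, `G|_{z_j = c} = G` for `G` free of `z_j`, and the
coefficients of a renamed series `r1_coeff_rename` of the landed neighbour R, `…StubRenameSpan.lean`).

**M1.** GIVEN the renaming-invariance package R (for every permutation `e` of the variables:
`𝒪_{ℚ-alg}(𝔻̄^∞)` is stable under `rename e`, `rename e (relAC n G) = relAC (e n) (rename e G)`, and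
the span of type (a) is stable), if `F = Σⱼ cⱼ · relAC nⱼ Gⱼ` is in the `ℚ`-span of type (a) and
`L ∈ 𝒪_{ℚ-alg}(𝔻̄^∞)` involves no variable of `F`, then `F · L` is in the span.

* KEY IDENTITY (`m1_relAC_mul`): `relAC m (G · L) = relAC m G · L` for `L` free of `z_m`
  (`∂_m L = 0`, `L|_{z_m = 1} = L|_{z_m = 0} = L`, and the three operators are multiplicative resp.
  derivations); so the claim is immediate when no direction `nⱼ` is a variable of `L` (`m1_easy`).
* In general the directions `nⱼ` that are variables of `L` are NOT variables of `F`; move them off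
  by the involution `e` of `ℕ` exchanging `l ↔ l + M` for the variables `l < M` of `L` (`M` beyond
  every variable in sight, `m1_exists_perm`): `e` fixes every variable of `F`, so `rename e F = F`
  (`m1_rename_eq_self`), and R rewrites the certificate as `F = Σⱼ cⱼ · relAC (e nⱼ) (rename e Gⱼ)`
  whose directions avoid the variables of `L`.

Elementary (folklore); no definition is introduced.
-/

noncomputable section

-- `Summit.KontsevichZagierPeriods.KontsevichZagierPeriods.…` is the tree's mandated layout (single-conjunct summit).
set_option linter.dupNamespace false

namespace Summit.KontsevichZagierPeriods.KontsevichZagierPeriods.TypeAGenerationLine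

open Finsupp MvPowerSeries
open Literature.NumberTheory.Transcendental
open Literature.NumberTheory.Transcendental.AyoubRel

/-! ## The key identity `relAC m (G · L) = relAC m G · L` -/

section KeyIdentity

variable {k : Type} [Field k] (σ : k →+* ℂ)

omit [Field k] in
/-- `∂_m L = 0` for `L` free of `z_m`. [folklore] -/
theorem m1_pdz_eq_zero_of_not_usesVar {L : CSeries} {m : ℕ} (h : ¬ UsesVar L m) : pdz m L = 0 := by
  ext a
  rw [StokesGenerationLine.coeff_pdz, map_zero]
  have h0 : coeff (a + single m 1) L = 0 := by
    by_contra hne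
    refine h ⟨a + single m 1, ?_, hne⟩
    rw [Finsupp.add_apply, single_eq_same]
    omega
  rw [h0, mul_zero]

/-- **Key identity**: `relAC m (G · L) = relAC m G · L` for `G, L ∈ 𝒪_{k-alg}(𝔻̄^∞)` and `L` free
of `z_m` (Leibniz rule with `∂_m L = 0`; the face maps are multiplicative and fix `L`).
[folklore] -/
theorem m1_relAC_mul {G L : CSeries} (hG : G ∈ Oan σ) (hL : L ∈ Oan σ) {m : ℕ}
    (h : ¬ UsesVar L m) : relAC m (G * L) = relAC m G * L := by
  simp only [relAC]
  rw [w1_pdz_mul, m1_pdz_eq_zero_of_not_usesVar h, mul_zero, add_zero,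
    s4_restrC_mul (summable_norm_coeff_of_mem_Oan σ hG) (summable_norm_coeff_of_mem_Oan σ hL),
    d1_restrC_one_of_not_usesVar h, s8_restrC_zero_mul, c3_restrC_zero_of_not_usesVar h]
  ring

/-- The disjoint case: if no direction `nⱼ` of the certificate `Σⱼ σ(cⱼ) · relAC nⱼ Gⱼ` is a
variable of `L ∈ 𝒪_{k-alg}(𝔻̄^∞)`, the product with `L` is the certificate
`Σⱼ σ(cⱼ) · relAC nⱼ (Gⱼ L)`. [folklore] -/
theorem m1_easy {n : ℕ} (c : Fin n → k) (nn : Fin n → ℕ) (G : Fin n → CSeries)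
    (hG : ∀ j, G j ∈ Oan σ) {L : CSeries} (hL : L ∈ Oan σ) (hn : ∀ j, ¬ UsesVar L (nn j)) :
    (∑ j, σ (c j) • relAC (nn j) (G j)) * L ∈
      kSpan σ {x : CSeries | ∃ G ∈ Oan σ, ∃ n : ℕ, x = relAC n G} := by
  refine ⟨n, c, fun j => relAC (nn j) (G j * L),
    fun j => ⟨G j * L, mul_mem_Oan σ (hG j) hL, nn j, rfl⟩, ?_⟩
  rw [Finset.sum_mul]
  refine Finset.sum_congr rfl fun j _ => ?_
  dsimp only
  rw [smul_mul_assoc, m1_relAC_mul σ (hG j) hL (hn j)]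

omit [Field k] in
/-- `relAC i` does not introduce variables. [folklore] -/
theorem m1_dependsOnlyOnLT_relAC {G : CSeries} {m : ℕ} (h : DependsOnlyOnLT G m) (i : ℕ) :
    DependsOnlyOnLT (relAC i G) m := by
  intro a ha
  rw [StokesGenerationLine.coeff_relAC, StokesGenerationLine.dependsOnlyOnLT_pdz i h a ha,
    StokesGenerationLine.dependsOnlyOnLT_restrC i 1 h a ha,
    StokesGenerationLine.dependsOnlyOnLT_restrC i 0 h a ha, sub_zero, add_zero]

omit [Field k] in
/-- A finite combination of series in the variables `z_0, …, z_{M-1}` is one. [folklore] -/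
theorem m1_dependsOnlyOnLT_sum {n : ℕ} (c : Fin n → ℂ) (s : Fin n → CSeries) {M : ℕ}
    (h : ∀ j, DependsOnlyOnLT (s j) M) : DependsOnlyOnLT (∑ j, c j • s j) M := by
  intro a ha
  rw [map_sum]
  exact Finset.sum_eq_zero fun j _ => by rw [coeff_smul, h j a ha, mul_zero]

end KeyIdentity

/-! ## Renaming by a permutation of the variables -/

section Rename

/-- A permutation moving no variable of `F` fixes `F` (coefficients of `rename e F` are
`coeff_b (rename e F) = F_{b ∘ e}`, `r1_coeff_rename`). [folklore] -/
theorem m1_rename_eq_self (e : ℕ ≃ ℕ) {F : CSeries} (h : ∀ l, e l ≠ l → ¬ UsesVar F l) :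
    MvPowerSeries.rename (⇑e) F = F := by
  ext b
  rw [r1_coeff_rename]
  by_cases hb : ∃ l, b l ≠ 0 ∧ e l ≠ l
  · obtain ⟨l, hbl, hel⟩ := hb
    have h1 : coeff b F = 0 := by
      by_contra hne
      exact h l hel ⟨b, hbl, hne⟩
    have h2 : coeff (mapDomain (⇑e.symm) b) F = 0 := by
      by_contra hne
      refine h (e.symm l) (fun hl => hel ?_) ⟨mapDomain (⇑e.symm) b, ?_, hne⟩
      · rw [Equiv.apply_symm_apply] at hl
        exact (congrArg e hl).trans (e.apply_symm_apply l)
      · rw [r1_mapDomain_symm_apply, Equiv.apply_symm_apply]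
        exact hbl
    rw [h1, h2]
  · push Not at hb
    have hbb : mapDomain (⇑e.symm) b = b := by
      ext l
      rw [r1_mapDomain_symm_apply]
      by_cases hl : b l = 0
      · by_cases hl' : b (e l) = 0
        · rw [hl, hl']
        · rw [e.injective (hb _ hl')]
      · rw [hb l hl]
    rw [hbb]

/-- The involution of `ℕ` exchanging `l ↔ l + M` for the `l < M` satisfying `P`: it moves every
such `l` beyond `M`, fixes the other `l < M`, and moves nothing else below `M`. [folklore] -/
theorem m1_exists_perm (M : ℕ) (P : ℕ → Prop) :
    ∃ e : ℕ ≃ ℕ, (∀ l, l < M → P l → e l = l + M) ∧ (∀ l, l < M → ¬ P l → e l = l) ∧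
      (∀ l, e l ≠ l → (l < M ∧ P l) ∨ M ≤ l) := by
  classical
  let f : ℕ → ℕ := fun l =>
    if l < M ∧ P l then l + M else if M ≤ l ∧ l < M + M ∧ P (l - M) then l - M else l
  have hA : ∀ l, l < M ∧ P l → f l = l + M := fun l hl => if_pos hl
  have hB : ∀ l, ¬ (l < M ∧ P l) → M ≤ l ∧ l < M + M ∧ P (l - M) → f l = l - M :=
    fun l h1 h2 => (if_neg h1).trans (if_pos h2)
  have hC : ∀ l, ¬ (l < M ∧ P l) → ¬ (M ≤ l ∧ l < M + M ∧ P (l - M)) → f l = l :=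
    fun l h1 h2 => (if_neg h1).trans (if_neg h2)
  have hf : Function.Involutive f := by
    intro l
    by_cases h1 : l < M ∧ P l
    · rw [hA l h1, hB (l + M) (fun h => absurd h.1 (by omega))
        ⟨by omega, by omega, by rw [Nat.add_sub_cancel]; exact h1.2⟩, Nat.add_sub_cancel]
    · by_cases h2 : M ≤ l ∧ l < M + M ∧ P (l - M)
      · rw [hB l h1 h2, hA (l - M) ⟨by omega, h2.2.2⟩]
        omega
      · rw [hC l h1 h2, hC l h1 h2]
  refine ⟨hf.toPerm f, fun l hl hP => ?_, fun l hl hP => ?_, fun l hl => ?_⟩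
  · rw [Function.Involutive.coe_toPerm]
    exact hA l ⟨hl, hP⟩
  · rw [Function.Involutive.coe_toPerm]
    exact hC l (fun h => hP h.2) (fun h => absurd h.1 (by omega))
  · rw [Function.Involutive.coe_toPerm] at hl
    by_cases h1 : l < M ∧ P l
    · exact Or.inl h1
    · by_cases h2 : M ≤ l ∧ l < M + M ∧ P (l - M)
      · exact Or.inr h2.1
      · exact absurd (hC l h1 h2) hl

end Rename

/-! ## Registered form -/

/-- **M1 — MODULE STRUCTURE of the span under disjoint-variable products**, GIVEN R: if `F` is type
(a) and `L ∈ 𝒪_{ℚ-alg}(𝔻̄^∞)` involves no variable of `F`, then `F·L` is type (a). (Rename the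
certificate's auxiliary variables off the variables of `L` by a permutation fixing the variables of
`F`; then `relAC m (G·L) = relAC m G · L` for `L` free of `z_m`.) This is how Ayoub's type-(b)
generators `f·L`, `∫f = 0`, reduce to type (a) once `f` is.
[cite: AyoubRelKZRevisited, Théorème 1.1 (b)] -/
theorem stub_moduleDisjoint_of :
    (∀ (e : ℕ ≃ ℕ),
      (∀ G : CSeries, G ∈ Oan (algebraMap ℚ ℂ) → MvPowerSeries.rename (⇑e) G ∈ Oan (algebraMap ℚ ℂ)) ∧
      (∀ (G : CSeries) (n : ℕ), G ∈ Oan (algebraMap ℚ ℂ) →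
        MvPowerSeries.rename (⇑e) (relAC n G) = relAC (e n) (MvPowerSeries.rename (⇑e) G)) ∧
      (∀ x : CSeries, x ∈ kSpan (algebraMap ℚ ℂ) {x : CSeries | ∃ G ∈ Oan (algebraMap ℚ ℂ), ∃ n : ℕ, x = relAC n G} →
        MvPowerSeries.rename (⇑e) x ∈
          kSpan (algebraMap ℚ ℂ) {x : CSeries | ∃ G ∈ Oan (algebraMap ℚ ℂ), ∃ n : ℕ, x = relAC n G})) →
    ∀ (F L : CSeries),
      F ∈ kSpan (algebraMap ℚ ℂ) {x : CSeries | ∃ G ∈ Oan (algebraMap ℚ ℂ), ∃ n : ℕ, x = relAC n G} →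
      L ∈ Oan (algebraMap ℚ ℂ) → (∀ l : ℕ, UsesVar L l → ¬ UsesVar F l) →
      F * L ∈ kSpan (algebraMap ℚ ℂ) {x : CSeries | ∃ G ∈ Oan (algebraMap ℚ ℂ), ∃ n : ℕ, x = relAC n G} := by
  intro hR F L hF hL hFL
  obtain ⟨n, c, s, hs, rfl⟩ := hF
  have hs' : ∀ j, ∃ (G : CSeries) (m : ℕ), G ∈ Oan (algebraMap ℚ ℂ) ∧ s j = relAC m G := fun j => by
    obtain ⟨G, hG, m, hm⟩ := hs j
    exact ⟨G, m, hG, hm⟩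
  choose G nn hG hsn using hs'
  obtain rfl : s = fun j => relAC (nn j) (G j) := funext hsn
  -- a bound `M` beyond every variable of `L`, of the `G j`, and every direction `nn j`
  have hGm : ∀ j, ∃ m, DependsOnlyOnLT (G j) m := fun j => (hG j).1
  choose m hm using hGm
  obtain ⟨mL, hmL⟩ := hL.1
  set M : ℕ := mL + Finset.univ.sup m + Finset.univ.sup nn + 1 with hM
  have hmM : ∀ j, m j ≤ M := fun j => by
    have := Finset.le_sup (f := m) (Finset.mem_univ j)
    omega
  have hnM : ∀ j, nn j < M := fun j => by
    have := Finset.le_sup (f := nn) (Finset.mem_univ j)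
    omega
  have hLM : DependsOnlyOnLT L M := hmL.mono (by omega)
  have hFM : DependsOnlyOnLT (∑ j, (algebraMap ℚ ℂ) (c j) • relAC (nn j) (G j)) M :=
    m1_dependsOnlyOnLT_sum _ _ fun j => m1_dependsOnlyOnLT_relAC ((hm j).mono (hmM j)) (nn j)
  -- the involution moving the variables of `L` beyond `M`
  obtain ⟨e, he1, he2, he3⟩ := m1_exists_perm M (UsesVar L)
  obtain ⟨hR1, hR2, -⟩ := hR e
  have hfix : MvPowerSeries.rename (⇑e) (∑ j, (algebraMap ℚ ℂ) (c j) • relAC (nn j) (G j)) =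
      ∑ j, (algebraMap ℚ ℂ) (c j) • relAC (nn j) (G j) := by
    refine m1_rename_eq_self e fun l hl => ?_
    rcases he3 l hl with ⟨-, hPl⟩ | hMl
    · exact hFL l hPl
    · exact fun hF => absurd (s6_lt_of_usesVar hFM hF) (not_lt.mpr hMl)
  have hdir : ∀ j, ¬ UsesVar L (e (nn j)) := fun j => by
    by_cases hP : UsesVar L (nn j)
    · rw [he1 _ (hnM j) hP]
      exact fun h => absurd (s6_lt_of_usesVar hLM h) (by omega)
    · rwa [he2 _ (hnM j) hP]
  -- the renamed certificate
  have hF' : (∑ j, (algebraMap ℚ ℂ) (c j) • relAC (nn j) (G j)) =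
      ∑ j, (algebraMap ℚ ℂ) (c j) • relAC (e (nn j)) (MvPowerSeries.rename (⇑e) (G j)) := by
    conv_lhs => rw [← hfix]
    rw [map_sum]
    refine Finset.sum_congr rfl fun j _ => ?_
    rw [map_smul, hR2 _ _ (hG j)]
  rw [hF']
  exact m1_easy (algebraMap ℚ ℂ) c (fun j => e (nn j)) (fun j => MvPowerSeries.rename (⇑e) (G j))
    (fun j => hR1 _ (hG j)) hL hdir

end Summit.KontsevichZagierPeriods.KontsevichZagierPeriods.TypeAGenerationLine
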